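import Summits.ResolutionOfSingularities.ResolutionOfSingularities.Theses.QuotientModels
import Summits.ResolutionOfSingularities.ResolutionOfSingularities.Theorems.QuotientModelsMinimalHeightTower
import Literature.AlgebraicGeometry.Resolution.GabberTemkinAlterations
import Literature.AlgebraicGeometry.Resolution.ProperModelsRegModel
import HarnessLib

/-!
# QuotientModelsTameDistillation — kernels of the decomp-res node «TameDistillation» (lens-6 g7) BY NAME

Source HOME/decomp-res-lens-6/g7/TameDistillation.lean (sha256 9bc5a9f3a3bbab78, 310 lines; critic `lean check`
rc 0 · 0 err · 0 warn · 0 sorry · `root_of` axioms standard), CRITIC-LEDGER row 45 (2026-08-30T06:58Z): CLEARED AS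
MAP NODE (residual 0 · decision 0 · map +1).  Pieces = asides of `Theses/QuotientModels.lean` rev 6: `SylowDescent`
29860 (refines E = `GaloisFixedModels` 27194), `RegModelsPerfect` 29861 and `SepPPowerDescent` 29862 (refine RM =
`RegularModels` 27197).


Layer A (EXACT, PROVED): `E ⟺ PGroupFixedModels (27205) ∧ SylowDescent (29860)` — the Sylow distillation: restrict the
Galois roof to a Sylow `p`-subgroup (27205's input), then descend the coprime NON-normal index (29860);
QuotientModels' header rules out «Tame 27204 ∧ PGroup 27205» as a split — `galoisFixedModels_iff` is the valid one. 
Certificates that each conjunct is WEAKER than E by letter: `SylowDescent` holds outright on `p`-groups,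
`PGroupFixedModels` on `p′`-groups. Layer B (EXACT modulo the tree's named fact `Temkin2017PAlteration`, PROVED):
`RegModelsPerfect ⟺ SepPPowerDescent` — an EQUIV RECORD (declared costume of the frame, not a bisection); map
content: on the PERFECT column the models half needs neither H (27195) nor the Galois/tame step
(`galoisFixedModels_perfect_of_sepPPowerDescent`, `heightOneDescent_perfect_of_sepPPowerDescent`).  `root_of` =
`QuotientModels.closes` BY NAME with E replaced by its split.
Why this is novel: the tame (`p′`) part of the models half is removed WITHOUT equivariance in the two honest ways
print offers (de Jong's Galois presentation ↦ Sylow descent; Temkin's tame distillation ↦ separable `p`-power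
descent), and the unknown step is typed as exactly one conjunct each time.  Census: T-SD-1 (desk) now, T-E-LS
(kit-small) later. -/

namespace Summit.ResolutionOfSingularities.ResolutionOfSingularities.Theorems.QuotientModelsTameDistillation

open CategoryTheory AlgebraicGeometry
open Literature.AlgebraicGeometry.Resolution
open Summit.ResolutionOfSingularities.ResolutionOfSingularities.Theses

/-! ## Layer A — the Sylow distillation of E (exact) -/

/-- **E ⟸ PGroupFixedModels ∧ SylowDescent**: choose a Sylow `p`-subgroup `P` (Mathlib `Sylow`), restrict the roof's
action to the `p`-group `P` — 27205 gives regular models of every presented `K'^P` — and descend the coprime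
non-normal index by 29860. [folklore] -/
theorem galoisFixedModels_of (hP : QuotientModels.PGroupFixedModels) (hS : QuotientModels.SylowDescent) :
    QuotientModels.GaloisFixedModels := by
  intro p hp k _ _ K' _ _ _ G _ _ ρ N' hN' hext K _ _ _ ι hfix hne
  haveI : Fact p.Prime := ⟨hp⟩
  obtain ⟨P⟩ := (inferInstance : Nonempty (Sylow p G))
  refine hS p hp k K' G ρ N' hN' hext P ?_ K ι hfix hne
  intro K₂ _ _ _ ι₂ hfix₂ hne₂
  refine hP p hp k K' (P : Subgroup G) (ρ.comp (P : Subgroup G).subtype) N' P.isPGroup' hN'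
    (fun g => hext (g : G)) K₂ ι₂ (fun y => ?_) hne₂
  rw [hfix₂ y]
  constructor
  · intro h g
    exact h (g : G) g.2
  · intro h g hg
    exact h ⟨g, hg⟩

/-- NECESSITY of 29860 inside E: `E ⟹ SylowDescent` (ignore the Sylow hypothesis). [folklore] -/
theorem sylowDescent_of_galoisFixedModels (hE : QuotientModels.GaloisFixedModels) :
    QuotientModels.SylowDescent :=
  fun p hp k _ _ K' _ _ _ G _ _ ρ N' hN' hext _ _ K _ _ _ ι hfix hne =>
    hE p hp k K' G ρ N' hN' hext K ι hfix hne

/-- `E ⟹ PGroupFixedModels` (27205 is the `p`-group slice of E). [folklore] -/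
theorem pGroupFixedModels_of_galoisFixedModels (hE : QuotientModels.GaloisFixedModels) :
    QuotientModels.PGroupFixedModels :=
  fun p hp k _ _ K' _ _ _ G _ _ ρ N' _ hN' hext K _ _ _ ι hfix hne =>
    hE p hp k K' G ρ N' hN' hext K ι hfix hne

/-- **EXACTNESS of layer A**: `GaloisFixedModels (27194) ⟺ PGroupFixedModels (27205) ∧ SylowDescent (29860)`.
[folklore] -/
theorem galoisFixedModels_iff :
    QuotientModels.GaloisFixedModels ↔ QuotientModels.PGroupFixedModels ∧ QuotientModels.SylowDescent :=
  ⟨fun h => ⟨pGroupFixedModels_of_galoisFixedModels h, sylowDescent_of_galoisFixedModels h⟩,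
    fun h => galoisFixedModels_of h.1 h.2⟩

/-- CERTIFICATE «29860 is WEAKER than E by letter»: on `p`-GROUPS `G` the statement of `SylowDescent` holds outright
(the Sylow subgroup is all of `G`, so its hypothesis already delivers the conclusion), while E restricted to
`p`-groups is the open 27205. [folklore] -/
theorem sylowDescent_pGroup_slice :
    ∀ p : ℕ, p.Prime → ∀ (k : Type) [Field k] [CharP k p] (K' : Type) [Field K'] [Algebra k K']
    [Algebra.EssFiniteType k K'] (G : Type) [Group G] [Finite G] (ρ : G →* (K' ≃ₐ[k] K'))
    (N' : ProperModel k K'), IsPGroup p G → Scheme.IsRegular N'.X →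
    (∀ g : G, ∃ φ : N'.X ≅ N'.X,
      Spec.map (CommRingCat.ofHom (ρ g).toAlgHom.toRingHom) ≫ N'.gen = N'.gen ≫ φ.hom) →
    ∀ (P : Sylow p G),
    (∀ (K₂ : Type) [Field K₂] [Algebra k K₂] [Algebra.EssFiniteType k K₂] (ι₂ : K₂ →ₐ[k] K'),
        (∀ y : K', y ∈ Set.range ι₂ ↔ ∀ g : G, g ∈ (P : Subgroup G) → ρ g y = y) →
        Nonempty (ProperModel k K₂) → ∃ N₂ : ProperModel k K₂, Scheme.IsRegular N₂.X) →
    ∀ (K : Type) [Field K] [Algebra k K] [Algebra.EssFiniteType k K] (ι : K →ₐ[k] K'),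
      (∀ y : K', y ∈ Set.range ι ↔ ∀ g : G, ρ g y = y) → Nonempty (ProperModel k K) →
      ∃ N : ProperModel k K, Scheme.IsRegular N.X := by
  intro p hp k _ _ K' _ _ _ G _ _ ρ N' hG _ _ P hinner K _ _ _ ι hfix hne
  have htop : (⊤ : Subgroup G) = (P : Subgroup G) := P.is_maximal' (hG.to_subgroup ⊤) le_top
  refine hinner K ι (fun y => ?_) hne
  rw [hfix y]
  constructor
  · intro h g _
    exact h g
  · intro h g
    exact h g (by rw [← htop]; exact Subgroup.mem_top g)

/-- CERTIFICATE «27205 is WEAKER than E by letter»: on groups of order prime to `p` a `p`-group is trivial, the fixed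
field is all of `K'`, and the roof itself is the regular model (transported along `K ≃ₐ[k] K'`), while E restricted to
`p′`-groups is 27204 (decided only over a perfect field with a projective roof). [folklore] -/
theorem pGroupFixedModels_coprime_slice :
    ∀ p : ℕ, p.Prime → ∀ (k : Type) [Field k] [CharP k p] (K' : Type) [Field K'] [Algebra k K']
    [Algebra.EssFiniteType k K'] (G : Type) [Group G] [Finite G] (ρ : G →* (K' ≃ₐ[k] K'))
    (N' : ProperModel k K'), IsPGroup p G → (Nat.card G).Coprime p → Scheme.IsRegular N'.X →
    (∀ g : G, ∃ φ : N'.X ≅ N'.X,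
      Spec.map (CommRingCat.ofHom (ρ g).toAlgHom.toRingHom) ≫ N'.gen = N'.gen ≫ φ.hom) →
    ∀ (K : Type) [Field K] [Algebra k K] [Algebra.EssFiniteType k K] (ι : K →ₐ[k] K'),
      (∀ y : K', y ∈ Set.range ι ↔ ∀ g : G, ρ g y = y) → Nonempty (ProperModel k K) →
      ∃ N : ProperModel k K, Scheme.IsRegular N.X := by
  intro p hp k _ _ K' _ _ _ G _ _ ρ N' hG hcop hN' _ K _ _ _ ι hfix _
  haveI : Fact p.Prime := ⟨hp⟩
  have hcard : Nat.card G = 1 := by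
    rcases hG.card_eq_or_dvd with h | h
    · exact h
    · exact absurd (Nat.Coprime.eq_one_of_dvd hcop.symm h) hp.one_lt.ne'
  haveI : Subsingleton G := (Nat.card_eq_one_iff_unique.mp hcard).1
  have hsurj : Function.Surjective ι := fun y => by
    have hy : y ∈ Set.range ι := (hfix y).mpr fun g => by
      rw [Subsingleton.elim g 1, map_one]
      rfl
    exact hy
  let e : K ≃ₐ[k] K' := AlgEquiv.ofBijective ι ⟨ι.toRingHom.injective, hsurj⟩
  exact ⟨N'.ofAlgEquiv e.symm, hN'⟩


/-! ## Layer B — Temkin's tame distillation: the perfect-column models half is separable `p`-power descent -/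

/-- `RegModelsPerfect (29861) ⟹ SepPPowerDescent (29862)` (ignore the alteration). [folklore] -/
theorem sepPPowerDescent_of_regModelsPerfect (h : QuotientModels.RegModelsPerfect) :
    QuotientModels.SepPPowerDescent :=
  fun p hp k _ _ _ K _ _ _ N _ _ _ _ _ _ => h p hp k K ⟨N⟩

/-- **`RegModelsPerfect ⟸ SepPPowerDescent` modulo Temkin 2017** (tree fact `Temkin2017PAlteration`, Thm 1.2.5): a
proper model `N` of `K` is an integral separated `k`-scheme of finite type; Temkin's theorem (with `Z = ∅`) gives a
regular `X₁` and an alteration `X₁ ⟶ N.X` of `p`-power degree, separable because `k` is perfect; descend by 29862.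
[cite: Temkin2017, Thm 1.2.5] -/
theorem regModelsPerfect_of_sepPPowerDescent (hT : Temkin2017PAlteration.{0})
    (hD : QuotientModels.SepPPowerDescent) : QuotientModels.RegModelsPerfect := by
  intro p hp k _ _ _ K _ _ _ hne
  obtain ⟨N⟩ := hne
  have hZ : (∅ : Set N.X) ≠ Set.univ := by
    haveI : Nonempty N.X := inferInstance
    exact Set.empty_ne_univ
  obtain ⟨X₁, φ, h, hreg, hdeg, -, hsep⟩ :=
    hT k N.X N.π inferInstance inferInstance inferInstance ∅ isClosed_empty hZ
  exact hD p hp k K N X₁ φ h hreg hdeg (hsep ‹PerfectField k›)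

/-- **EXACTNESS of layer B** (modulo the port): `RegModelsPerfect (29861) ⟺ SepPPowerDescent (29862)`. [folklore] -/
theorem regModelsPerfect_iff_sepPPowerDescent (hT : Temkin2017PAlteration.{0}) :
    QuotientModels.RegModelsPerfect ↔ QuotientModels.SepPPowerDescent :=
  ⟨sepPPowerDescent_of_regModelsPerfect, regModelsPerfect_of_sepPPowerDescent hT⟩

/-- The frame 29861 is the perfect column of `RegularModels` (27197). [folklore] -/
theorem regModelsPerfect_of_regularModels (h : QuotientModels.RegularModels) :
    QuotientModels.RegModelsPerfect :=
  fun p hp k _ _ _ K _ _ _ hne => h p hp k K hne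

/-! ## Cross-links: over a perfect field Temkin's residual dominates de Jong's pieces -/

/-- `SepPPowerDescent` (mod Temkin) gives E (27194) on the perfect column. [folklore] -/
theorem galoisFixedModels_perfect_of_sepPPowerDescent (hT : Temkin2017PAlteration.{0})
    (hD : QuotientModels.SepPPowerDescent) :
    ∀ p : ℕ, p.Prime → ∀ (k : Type) [Field k] [CharP k p] [PerfectField k] (K' : Type) [Field K']
    [Algebra k K'] [Algebra.EssFiniteType k K'] (G : Type) [Group G] [Finite G]
    (ρ : G →* (K' ≃ₐ[k] K')) (N' : ProperModel k K'), Scheme.IsRegular N'.X →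
    (∀ g : G, ∃ φ : N'.X ≅ N'.X,
      Spec.map (CommRingCat.ofHom (ρ g).toAlgHom.toRingHom) ≫ N'.gen = N'.gen ≫ φ.hom) →
    ∀ (K : Type) [Field K] [Algebra k K] [Algebra.EssFiniteType k K] (ι : K →ₐ[k] K'),
      (∀ y : K', y ∈ Set.range ι ↔ ∀ g : G, ρ g y = y) → Nonempty (ProperModel k K) →
      ∃ N : ProperModel k K, Scheme.IsRegular N.X :=
  fun p hp k _ _ _ _ _ _ _ _ _ _ _ _ _ _ K _ _ _ _ _ hne =>
    regModelsPerfect_of_sepPPowerDescent hT hD p hp k K hne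

/-- `SepPPowerDescent` (mod Temkin) gives H (27195) on the perfect column: separable `p`-power descent implies
height-one (purely inseparable) descent there. [folklore] -/
theorem heightOneDescent_perfect_of_sepPPowerDescent (hT : Temkin2017PAlteration.{0})
    (hD : QuotientModels.SepPPowerDescent) :
    ∀ p : ℕ, p.Prime → ∀ (k : Type) [Field k] [CharP k p] [PerfectField k] (K L : Type) [Field K]
    [Field L] [Algebra k K] [Algebra k L] [Algebra K L] [IsScalarTower k K L]
    [Algebra.EssFiniteType k K] [Module.Finite K L], (∀ x : L, x ^ p ∈ (algebraMap K L).range) →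
    (∃ N : ProperModel k L, Scheme.IsRegular N.X) → ∃ N : ProperModel k K, Scheme.IsRegular N.X :=
  fun p hp k _ _ _ K _ _ _ _ _ _ _ _ _ _ _ =>
    regModelsPerfect_of_sepPPowerDescent hT hD p hp k K (ProperModel.nonempty_of_essFiniteType k K)

/-! ## Necessity from the ROOT and the upward assembly BY NAME -/

/-- ROOT ⟹ `RegModelsPerfect` (29861). [folklore] -/
theorem regModelsPerfect_of_root (h : _root_.ResolutionOfSingularities) : QuotientModels.RegModelsPerfect :=
  fun p hp k _ _ _ K _ _ _ hne => ProperModel.regModel_of_resolutionInChar (h p hp) k K hne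

/-- ROOT ⟹ `SepPPowerDescent` (29862). [folklore] -/
theorem sepPPowerDescent_of_root (h : _root_.ResolutionOfSingularities) : QuotientModels.SepPPowerDescent :=
  sepPPowerDescent_of_regModelsPerfect (regModelsPerfect_of_root h)

/-- ROOT ⟹ `SylowDescent` (29860). [folklore] -/
theorem sylowDescent_of_root (h : _root_.ResolutionOfSingularities) : QuotientModels.SylowDescent :=
  fun p hp k _ _ _ _ _ _ _ _ _ _ _ _ _ _ _ K _ _ _ _ _ hne =>
    ProperModel.regModel_of_resolutionInChar (h p hp) k K hne

/-- **Upward assembly BY NAME**: `QuotientModels.closes` with E replaced by its exact split — `ROOT ⟸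
SandwichedResolve (24572) ∧ GaloisTower (27196, port) ∧ PGroupFixedModels (27205) ∧ SylowDescent (29860) ∧
HeightOneDescent (27195)`. Every hypothesis is consumed. [folklore] -/
theorem root_of (hMR : QuotientModels.SandwichedResolve) (hC : QuotientModels.GaloisTower)
    (hP : QuotientModels.PGroupFixedModels) (hS : QuotientModels.SylowDescent)
    (hH : QuotientModels.HeightOneDescent) : _root_.ResolutionOfSingularities :=
  QuotientModels.closes hMR hC (galoisFixedModels_of hP hS) hH

/-- EXACTNESS of the assembly at the models half: `E ∧ H ⟺ PGroupFixedModels ∧ SylowDescent ∧ H`. [folklore] -/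
theorem modelsPieces_iff :
    (QuotientModels.GaloisFixedModels ∧ QuotientModels.HeightOneDescent) ↔
      (QuotientModels.PGroupFixedModels ∧ QuotientModels.SylowDescent ∧ QuotientModels.HeightOneDescent) := by
  rw [galoisFixedModels_iff, and_assoc]

/-- All three new pieces are summit-implied. [folklore] -/
theorem pieces_of_root (h : _root_.ResolutionOfSingularities) :
    QuotientModels.SylowDescent ∧ QuotientModels.RegModelsPerfect ∧ QuotientModels.SepPPowerDescent :=
  ⟨sylowDescent_of_root h, regModelsPerfect_of_root h, sepPPowerDescent_of_root h⟩

end Summit.ResolutionOfSingularities.ResolutionOfSingularities.Theorems.QuotientModelsTameDistillation
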